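import Summits.BirchSwinnertonDyer.BirchSwinnertonDyer.Theorems.SignedLowerHalvesSmallImageLowerHalfBothSignsRttCharRoadE2JunctionDepleted
import Summits.BirchSwinnertonDyer.BirchSwinnertonDyer.Theorems.SignedLowerHalvesSmallImageLowerHalfBothSignsRttD2SpecialisationRegOfDef
import HarnessLib

/-!
# Route `SignedLowerHalves`, crux L `SmallImageLowerHalfBothSigns` (stmt-BirchSwinnertonDyer-23599), line `rtt_w3` v14 — E2 FROM ROAD D + THE DEPLETED JUNCTION
# (RULING (F1)): the E2 glue with `hK` discharged through the S₀K-strict sub-carrier and the S₀-depleted zeta class, `hreg` derived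

WHY (-w3 g22 J3 DESIGN NOTE 19:23Z (F1), LEAD RULING; sequel of `…RttCharRoadE2JunctionDepleted`). As p780454's `charRoad_E2_of_roadD_junction_exact` / p782187's
`…_of_torsionBy_eq_bot`, but with the junction in its depleted shape: `s = sp¹ : Hsp → B` (full carrier, f.g. over `Λ`, `B ⧸ range s` torsion with `λ ≤ λ(H2[f])`),
an injective `ιB : B' → B` (strict sub-carrier), a depletion `E ≠ 0` with a depleted specialisation `s' : Hsp → B'`, `ιB ∘ s' = E • s`, the Poitou–Tate map
`j₀ : B' → Q` with `Function.Exact j₀ gX`, the element `z := j₀ (s' ζ̄)` (so `hz`, `hjz` are free), and the J4 target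
`hY : λ(H2/f) + λ(Λ_𝒪 ⧸ (E)) ≤ λ(coker gX) + λ(B ⧸ range ιB)`. ★★★★ `charRoad_E2_of_roadD_junction_depleted`: conclusion = the E2-tail for `X'`; `z ≠ 0`, `hmeet`, the
f.g.-torsion of `ker gX ⧸ ∙z` derived from `Col`/(an) as in p780454; `hreg` derived (p782187); `hK` = `lambdaInvariant_quotient_span_le_of_roadD_junction_depleted`.

THEOREMS ONLY (`--supports stmt-BirchSwinnertonDyer-23599` helper); closes nothing; crux L, crux M, E2 and BSD remain OPEN and are proved for NO curve by any of this.
[cite: Kobayashi2003, Thm. 7.3 i), Thm. 1.3] [cite: GreenbergVatsal2000, §2 Prop. (2.4)] [cite: JohnsonLeungKings2011, Thm. 5.2, Cor. 5.3] [cite: PollackRubin2004, §6–§7]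
[cite: Washington1997, §13.2]
-/

set_option autoImplicit false
-- the Theorems namespace of this sub repeats the summit name by design (D-0017 nested layout)
set_option linter.dupNamespace false

noncomputable section
open scoped Pointwise Classical MatrixGroups ModularForm

open PowerSeries Literature.NumberTheory.Automorphic Literature.NumberTheory.EllipticCurves Literature.NumberTheory.EllipticCurves.Module
open Literature.NumberTheory.ComplexMultiplication.EllipticUnits.JohnsonLeungKings2011
open Summit.BirchSwinnertonDyer.BirchSwinnertonDyer.Theorems.SmallImageRttD2LamSpec
open Literature.NumberTheory.IwasawaTheory Literature.NumberTheory.EllipticCurves.GreenbergVatsal2000 CongruenceSubgroup NumberField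
  IsDedekindDomain Rat.HeightOneSpectrum Literature.NumberTheory.EllipticCurves.ModularForms

namespace Summit.BirchSwinnertonDyer.BirchSwinnertonDyer.Theorems.SmallImageRttCharRoad

universe u v w w' w''

section E2

variable {p : ℕ} [Fact p.Prime] {S : Set (PadicAlgCl p)} [Algebra (IwasawaAlgebra p) (IwasawaAlgebraO S)]

set_option maxHeartbeats 400000 in -- same budget line as p780454
/-- ★★★★ **E2 from road D through the DEPLETED junction** (exactness form, `hreg` derived). See the module docstring. [cite: Kobayashi2003, Thm. 7.3 i)]
[cite: GreenbergVatsal2000, §2 Prop. (2.4)] [cite: JohnsonLeungKings2011, Thm. 5.2, Cor. 5.3] [cite: Washington1997, §13.2] -/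
theorem charRoad_E2_of_roadD_junction_depleted [FiniteDimensional ℚ_[p] (padicCoeffField S)] (hS : 0 < Module.finrank ℚ_[p] (padicCoeffField S))
    (halg : ∀ r : IwasawaAlgebra p, algebraMap (IwasawaAlgebra p) (IwasawaAlgebraO S) r = iwasawaToIwasawaO S r)
    {M : ℕ} [NeZero M] (g : CuspForm (Gamma0 M) 2) (ι : coeffField g →+* PadicAlgCl p) (hng : IsNewform0 g)
    (S₀ : Finset (HeightOneSpectrum (𝓞 ℚ)))
    {Q X' : Type} [AddCommGroup Q] [AddCommGroup X'] [Module (IwasawaAlgebraO S) Q] [Module (IwasawaAlgebra p) Q]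
    [IsScalarTower (IwasawaAlgebra p) (IwasawaAlgebraO S) Q] [Module (IwasawaAlgebraO S) X'] [Module (IwasawaAlgebra p) X']
    [IsScalarTower (IwasawaAlgebra p) (IwasawaAlgebraO S) X'] [Module.Finite (IwasawaAlgebra p) X'] (hX' : Module.IsTorsion (IwasawaAlgebra p) X')
    (gX : Q →ₗ[IwasawaAlgebraO S] X') (b : padicCoeffIntegers S) (φ : PowerSeries (IwasawaAlgebraO S) →+* IwasawaAlgebraO S)
    (hφf : φ (C (X - C b)) = 0) (hC : ∀ a : padicCoeffIntegers S, φ (C (C a)) = C a) (hX : φ X = X)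
    (hker : RingHom.ker φ = Ideal.span {C (X - C b)})
    {Aidx H0 H1 H2 : Type v} [AddCommGroup H0]
    [Module (PowerSeries (IwasawaAlgebraO S)) H0] [AddCommGroup H1] [Module (PowerSeries (IwasawaAlgebraO S)) H1] [AddCommGroup H2]
    [Module (PowerSeries (IwasawaAlgebraO S)) H2] [Module.Finite (PowerSeries (IwasawaAlgebraO S)) H1]
    [Module.Finite (PowerSeries (IwasawaAlgebraO S)) H2]
    (D : ZetaSkeleton (PowerSeries (IwasawaAlgebraO S)) Aidx H0 H1 H2) (h52 : D.Thm52Shape)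
    (hdef : Submodule.torsionBy (PowerSeries (IwasawaAlgebraO S)) (H1 ⧸ D.Z) (C (X - C b)) = ⊥)
    [Module (IwasawaAlgebraO S) (QuotSMulTop (C (X - C b) : PowerSeries (IwasawaAlgebraO S)) H1)]
    (hιH : ∀ (l : IwasawaAlgebraO S) (x : QuotSMulTop (C (X - C b) : PowerSeries (IwasawaAlgebraO S)) H1),
      l • x = (PowerSeries.map (PowerSeries.C : padicCoeffIntegers S →+* IwasawaAlgebraO S) l) • x)
    [Module (IwasawaAlgebra p) (QuotSMulTop (C (X - C b) : PowerSeries (IwasawaAlgebraO S)) H1)]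
    [IsScalarTower (IwasawaAlgebra p) (IwasawaAlgebraO S) (QuotSMulTop (C (X - C b) : PowerSeries (IwasawaAlgebraO S)) H1)]
    [Module (IwasawaAlgebra p) (Submodule.torsionBy (PowerSeries (IwasawaAlgebraO S)) H2 (C (X - C b)))]
    (hΛT : ∀ (r : IwasawaAlgebra p) (x : Submodule.torsionBy (PowerSeries (IwasawaAlgebraO S)) H2 (C (X - C b))),
      r • x = (PowerSeries.map (PowerSeries.C : padicCoeffIntegers S →+* IwasawaAlgebraO S) (iwasawaToIwasawaO S r)) • x)
    [Module (IwasawaAlgebra p) (QuotSMulTop (C (X - C b) : PowerSeries (IwasawaAlgebraO S)) H2)]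
    (hΛ2 : ∀ (r : IwasawaAlgebra p) (x : QuotSMulTop (C (X - C b) : PowerSeries (IwasawaAlgebraO S)) H2),
      r • x = (PowerSeries.map (PowerSeries.C : padicCoeffIntegers S →+* IwasawaAlgebraO S) (iwasawaToIwasawaO S r)) • x)
    (ζ : QuotSMulTop (C (X - C b) : PowerSeries (IwasawaAlgebraO S)) H1) (hζ : (D.Z).map ((C (X - C b) : PowerSeries (IwasawaAlgebraO S)) • (⊤ : Submodule (PowerSeries (IwasawaAlgebraO S)) H1)).mkQ =
      Submodule.span (PowerSeries (IwasawaAlgebraO S)) {ζ})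
    -- the DEPLETED junction (RULING (F1)): `s = sp¹` into the full carrier `B`; S₀K-strict sub-carrier `ι : B' ↪ B`; depletion `E`; depleted specialisation
    -- `s' : Hsp → B'` with `ιB ∘ s' = E • s`; Poitou–Tate `j₀ : B' → Q` exact with `gX`; the element is `z := j₀ (s' ζ̄)`
    {B : Type w} [AddCommGroup B] [Module (IwasawaAlgebraO S) B] [Module (IwasawaAlgebra p) B] [IsScalarTower (IwasawaAlgebra p) (IwasawaAlgebraO S) B]
    [Module.Finite (IwasawaAlgebra p) B]
    {B' : Type w''} [AddCommGroup B'] [Module (IwasawaAlgebraO S) B'] [Module (IwasawaAlgebra p) B'] [IsScalarTower (IwasawaAlgebra p) (IwasawaAlgebraO S) B']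
    (s : QuotSMulTop (C (X - C b) : PowerSeries (IwasawaAlgebraO S)) H1 →ₗ[IwasawaAlgebraO S] B)
    (htB : Module.IsTorsion (IwasawaAlgebra p) (B ⧸ LinearMap.range s))
    (hcoker : lambdaInvariant p (B ⧸ LinearMap.range s) ≤ lambdaInvariant p (Submodule.torsionBy (PowerSeries (IwasawaAlgebraO S)) H2 (C (X - C b))))
    (ιB : B' →ₗ[IwasawaAlgebraO S] B) (hιB : Function.Injective ιB) (E : IwasawaAlgebraO S) (hE : E ≠ 0)
    (s' : QuotSMulTop (C (X - C b) : PowerSeries (IwasawaAlgebraO S)) H1 →ₗ[IwasawaAlgebraO S] B') (hs' : ∀ x, ιB (s' x) = E • s x)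
    (j₀ : B' →ₗ[IwasawaAlgebraO S] Q) (hexact : Function.Exact j₀ gX)
    (hY : lambdaInvariant p (QuotSMulTop (C (X - C b) : PowerSeries (IwasawaAlgebraO S)) H2) + lambdaInvariant p (IwasawaAlgebraO S ⧸ Ideal.span {E}) ≤
      lambdaInvariant p (X' ⧸ LinearMap.range gX) + lambdaInvariant p (B ⧸ LinearMap.range ιB))
    (Col : Q ≃ₗ[IwasawaAlgebraO S] IwasawaAlgebraO S) (L : IwasawaAlgebraO (Set.range ι)) (hL : L ≠ 0) {c : PadicAlgCl p} (hc : c ≠ 0)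
    (fv : HeightOneSpectrum (𝓞 ℚ) → ℤ_[p]) (hfv : ∀ v ∈ S₀, fv v ≠ 0 ∧ (fv v).valuation = (frobeniusExponent p (natGenerator v : ℤ_[p])).valuation)
    (hCol : iwasawaOToPowerSeries S (Col (j₀ (s' ζ))) =
      PowerSeries.C c * iwasawaOToPowerSeries (Set.range ι) L *
        ∏ v ∈ S₀, Polynomial.aeval (PowerSeries.C ((natGenerator v : PadicAlgCl p)⁻¹) *
            (PowerSeries.binomialSeries ℤ_[p] (fv v)).map (algebraMap ℤ_[p] (PadicAlgCl p)))
          (1 - Polynomial.C (embCoeff g ι (natGenerator v)) * Polynomial.X +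
            (if natGenerator v ∣ M then 0 else Polynomial.C (natGenerator v : PadicAlgCl p)) * Polynomial.X ^ 2)) :
    ∃ d : ℕ, (∀ k : ℕ, ‖PowerSeries.coeff k (iwasawaOToPowerSeries (Set.range ι) L)‖ ≤
        ‖PowerSeries.coeff d (iwasawaOToPowerSeries (Set.range ι) L)‖) ∧
      (∀ k : ℕ, k < d → ‖PowerSeries.coeff k (iwasawaOToPowerSeries (Set.range ι) L)‖ <
        ‖PowerSeries.coeff d (iwasawaOToPowerSeries (Set.range ι) L)‖) ∧
      Module.finrank ℚ_[p] (padicCoeffField S) * (d + ∑ v ∈ S₀, p ^ (frobeniusExponent p (natGenerator v : ℤ_[p])).valuation *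
        layerLambda ((1 - Polynomial.C (embCoeff g ι (natGenerator v)) * Polynomial.X +
          (if natGenerator v ∣ M then 0 else Polynomial.C (natGenerator v : PadicAlgCl p)) * Polynomial.X ^ 2).comp
            (Polynomial.C ((natGenerator v : PadicAlgCl p)⁻¹) * (Polynomial.X + 1)))) ≤ lambdaInvariant p X' := by
  -- the element and the surjection onto `ker gX`
  set z : Q := j₀ (s' ζ) with hzdef
  have hz : gX z = 0 := (hexact z).mpr ⟨s' ζ, rfl⟩
  have hmem : ∀ x : B', j₀ x ∈ LinearMap.ker gX := fun x ↦ by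
    rw [LinearMap.mem_ker]
    exact (hexact (j₀ x)).mpr ⟨x, rfl⟩
  let j : B' →ₗ[IwasawaAlgebraO S] LinearMap.ker gX := LinearMap.codRestrict (LinearMap.ker gX) j₀ hmem
  have hj : Function.Surjective j := by
    rintro ⟨y, hy⟩
    obtain ⟨x, rfl⟩ := (hexact y).mp (LinearMap.mem_ker.mp hy)
    exact ⟨x, rfl⟩
  have hjz : j (s' ζ) = ⟨z, hz⟩ := rfl
  have hreg := not_charIdeal_le_span_of_thm52Shape_of_torsionBy_eq_bot p S b φ hker D h52 hdef
  haveI : FiniteDimensional ℚ_[p] (padicCoeffField S) := Module.finite_of_finrank_pos hS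
  haveI : IsDiscreteValuationRing (padicCoeffIntegers S) := by
    rw [padicCoeffIntegers_eq_unitBall S]; exact LambdaLowerBoundO.isDiscreteValuationRing_unitBall p _
  -- `Q ≅ Λ_𝒪` is torsion-free and Noetherian
  haveI : NoZeroSMulDivisors (IwasawaAlgebraO S) Q := by
    refine ⟨fun {c x} h ↦ ?_⟩
    have h' : c * Col x = 0 := by rw [← smul_eq_mul, ← map_smul, h, map_zero]
    exact (mul_eq_zero.mp h').imp_right fun hx ↦ Col.injective (by rw [hx, map_zero])
  haveI : IsNoetherian (IwasawaAlgebraO S) Q := isNoetherian_of_linearEquiv Col.symm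
  -- `z ≠ 0` from (an)
  haveI : FiniteDimensional ℚ (coeffField g) := IsNewform0.finiteDimensional_coeffField_holds hng
  haveI : FiniteDimensional ℚ_[p] (padicCoeffField (Set.range ι)) := GreenbergSelmer.finiteDimensional_padicCoeffField ι
  have hz0 : z ≠ 0 := by
    obtain ⟨d, hle, hlt⟩ := SmallImageRttE2Num.exists_normLambda_iwasawaAlgebraO p (Set.range ι) L hL
    have hL' : iwasawaOToPowerSeries (Set.range ι) L ≠ 0 :=
      (map_ne_zero_iff _ (iwasawaOToPowerSeries_injective _)).mpr hL
    have hP : ∀ v ∈ S₀, (1 - Polynomial.C (embCoeff g ι (natGenerator v)) * Polynomial.X +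
        (if natGenerator v ∣ M then 0 else Polynomial.C (natGenerator v : PadicAlgCl p)) * Polynomial.X ^ 2) ≠ 0 :=
      fun v _ h0 ↦ by
        have h1 := congrArg (fun P : Polynomial (PadicAlgCl p) ↦ P.coeff 0) h0
        simp only [Polynomial.coeff_add, Polynomial.coeff_sub, Polynomial.coeff_one_zero, Polynomial.coeff_C_mul,
          Polynomial.coeff_X_zero, mul_zero, sub_zero, Polynomial.coeff_zero] at h1
        split_ifs at h1 with hd
        · simp only [zero_mul, Polynomial.coeff_zero, add_zero, one_ne_zero] at h1
        · simp only [Polynomial.coeff_C_mul, Polynomial.coeff_X_pow, mul_ite, mul_one, mul_zero] at h1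
          norm_num at h1
    have hu : ∀ v ∈ S₀, ((natGenerator v : PadicAlgCl p))⁻¹ ≠ 0 := fun v _ ↦
      inv_ne_zero (Nat.cast_ne_zero.mpr (prime_natGenerator v).ne_zero)
    have hColz : Col z ≠ 0 := ne_zero_of_eulerProduct S S₀ hc hL' hle hlt _ _ fv hP hu (fun v hv ↦ (hfv v hv).1) hCol
    intro h0
    exact hColz (by rw [h0, map_zero])
  -- `hmeet`: `l • z = 0 ⇒ l = 0`
  have hmeet : ∀ l : IwasawaAlgebraO S, l • j (s' ζ) = 0 → l • ζ = 0 := fun l hl ↦ by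
    rw [hjz] at hl
    have hl' : l • z = 0 := by simpa using congrArg Subtype.val hl
    rcases eq_zero_or_eq_zero_of_smul_eq_zero hl' with h | h
    · rw [h, zero_smul]
    · exact absurd h hz0
  -- `ker gX ⧸ Λ_𝒪∙z` is finitely generated torsion over `Λ` (`a := Col z ≠ 0` kills it)
  haveI : Module.Finite (IwasawaAlgebra p) (LinearMap.ker gX ⧸ Submodule.span (IwasawaAlgebraO S) {j (s' ζ)}) :=
    moduleFinite_of_moduleFinite_iwasawaAlgebraO p S halg _
  have htO : Module.IsTorsion (IwasawaAlgebraO S) (LinearMap.ker gX ⧸ Submodule.span (IwasawaAlgebraO S) {j (s' ζ)}) := by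
    intro x
    refine ⟨⟨Col z, mem_nonZeroDivisors_of_ne_zero fun h ↦ hz0 (Col.injective (by rw [h, map_zero]))⟩, ?_⟩
    obtain ⟨y, rfl⟩ := Submodule.Quotient.mk_surjective _ x
    rw [Submonoid.mk_smul, ← Submodule.Quotient.mk_smul, Submodule.Quotient.mk_eq_zero, Submodule.mem_span_singleton, hjz]
    refine ⟨Col (y : Q), Subtype.ext ?_⟩
    change Col (y : Q) • z = Col z • (y : Q)
    apply Col.injective
    rw [map_smul, map_smul, smul_eq_mul, smul_eq_mul, mul_comm]
  have ht : Module.IsTorsion (IwasawaAlgebra p) (LinearMap.ker gX ⧸ Submodule.span (IwasawaAlgebraO S) {j (s' ζ)}) :=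
    isTorsion_of_isTorsion_iwasawaAlgebraO p S halg _ htO
  -- the glue's `hK` by name, then the glue
  have hK := lambdaInvariant_quotient_span_le_of_roadD_junction_depleted p S b φ hφf hC hX hker D h52 hreg hdef hιH halg hΛT hΛ2 ζ hζ
    s htB hcoker ιB hιB E hE (s' ζ) (hs' ζ) j hj hmeet ht hY
  rw [hjz] at hK
  exact charRoad_E2_of_localisation hS halg g ι hng S₀ hX' gX z hz hK Col L hL hc fv hfv hCol

end E2

end Summit.BirchSwinnertonDyer.BirchSwinnertonDyer.Theorems.SmallImageRttCharRoad

end
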